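import Literature.AnabelianGeometry.SemiGraphs.InterfaceVocab

/-!
# Categories of localizations ([SemiAnbd] §4: Def 4.1, Rmk 4.1.1–4.1.2, the category `Loc(𝔾, Γ)`)

Mochizuki, *Semi-graphs of anabelioids*, Publ. RIMS **42** (2006), §4 pp.50–52 of the author's
manuscript (kurims `paper:url-f33ace170ff4`). [cite: MochizukiSemiAnbd2006, Def 4.1, p. 50]

Typed over the §§1–3 interface `SemiAnbdVocab` (`InterfaceVocab.lean`, TODO-merge
abc-iut-L3-t1/t2).  Standing data of §4 (p.50): `G` a totally aloof, verticially slim semi-graph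
of anabelioids (an object of the ambient category of the interface) and `Γ` "a finite group of
automorphisms of `G` [i.e., `Γ` acts faithfully on `G`]" — a subgroup `Γ ≤ Aut G` (finiteness is a
hypothesis of the statements that need it, not of the definitions).

* Def 4.1 (i) `IsPiecewiseFaithful`; (ii) `SemiAnbdVocab.IsImmersion` / `IsExcision` /
  `IsEmbedding` (locally trivial + the underlying morphism of semi-graphs is so); (iii)
  `GStructure` = a `(𝔾, Γ)`-structure (a `Γ`-orbit of locally finite étale morphisms `H → 𝔾`),
  iso-immersive / iso-excisive, compatibility of an arrow with `(𝔾, Γ)`-structures; (iv)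
  `LocalGStructure` (one `(𝔾, Γ)`-structure on each `H[c]`, agreeing on the `H[b]`), its
  adjectives, local compatibility.
* Rmk 4.1.1: the `Γ`-orbit of components of `𝔾` determined by a component, `𝔾`-open / `𝔾`-closed
  edges (definitions) and the printed claim (`GOpenClosedPreservedStatement`, a predicate).
  Rmk 4.1.2: expository ("simulate a stack-theoretic situation"), not typed.
* The category `Loc(𝔾, Γ)` (pp.51–52), defined when `Γ` acts piecewise faithfully and `𝔾` is
  finite, connected, coherent, totally elevated, totally universally sub-coverticial: objects
  `LocObj` = closed (connected finite étale coverings of `𝔾` with their `𝔾`-structure) ∐ infinite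
  open (connected tempered coverings of infinite degree) ∐ finite open (finite, connected,
  quasi-coherent, totally elevated, totally universally sub-coverticial `H` with an iso-immersive,
  verticially iso-excisive local `(𝔾, Γ)`-structure and a non-isolated open `𝔾`-closed edge);
  arrows `LocHom` = locally finite étale arrows, over `𝔾` between tempered objects, compatible
  with the local `(𝔾, Γ)`-structures out of a finite open object, none from tempered to finite
  open.  `instance : Category (LocObj 𝓥 G Γ)` with the category laws PROVED from the interface's
  functoriality laws.  "Of infinite degree" is rendered "tempered and not finite étale" (Def 3.5:
  the finite objects of `B^cov(𝔾)` are those of `B(𝔾)`).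
Def 4.2, Props 4.3–4.7, Thm 4.8 and Rmks 4.2.1–4.8.4 are typed in `LocalizationsProperties.lean`.
Nothing in this file asserts a result of the paper; the five theorems are category bookkeeping.
-/

namespace Literature.AnabelianGeometry.SemiGraphs

open _root_.CategoryTheory

universe u v w

variable {Obj : Type u} [Category.{v} Obj] (𝓥 : SemiAnbdVocab.{u, v, w} Obj)

namespace SemiAnbdVocab

/-! ### Definition 4.1 (ii) -/

/-- **Def 4.1 (ii)** *immersion*: a locally trivial morphism of totally aloof, verticially slim
semi-graphs of anabelioids whose underlying morphism of semi-graphs is an immersion.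
[cite: MochizukiSemiAnbd2006, Def 4.1 (ii), p. 50] -/
def IsImmersion {H K : Obj} (f : H ⟶ K) : Prop := 𝓥.IsLocallyTrivial f ∧ 𝓥.IsGraphImmersion f

/-- **Def 4.1 (ii)** *excision*: locally trivial with excisive underlying morphism of semi-graphs.
[cite: MochizukiSemiAnbd2006, Def 4.1 (ii), p. 50] -/
def IsExcision {H K : Obj} (f : H ⟶ K) : Prop := 𝓥.IsLocallyTrivial f ∧ 𝓥.IsGraphExcision f

/-- **Def 4.1 (ii)** *embedding*: locally trivial with an embedding as underlying morphism of
semi-graphs. [cite: MochizukiSemiAnbd2006, Def 4.1 (ii), p. 50] -/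
def IsEmbedding {H K : Obj} (f : H ⟶ K) : Prop := 𝓥.IsLocallyTrivial f ∧ 𝓥.IsGraphEmbedding f

end SemiAnbdVocab

namespace Loc

variable (G : Obj) (Γ : Subgroup (Aut G))

/-! ### Definition 4.1 (i) -/

/-- **Def 4.1 (i)**: `Γ` *acts piecewise faithfully* on `𝔾` if every `γ ∈ Γ` that fixes some
vertex `v` of `𝔾` "as well as all of the branches of closed edges of `𝔾` that abut to `v`" is the
identity. [cite: MochizukiSemiAnbd2006, Def 4.1 (i), p. 50] -/
def IsPiecewiseFaithful (G : Obj) (Γ : Subgroup (Aut G)) : Prop :=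
  ∀ γ ∈ Γ, (∃ v : 𝓥.Vert G, 𝓥.mapV γ.hom v = v ∧
      ∀ x : (Σ e : 𝓥.Edge G, 𝓥.Br e), 𝓥.IsClosedEdge x.1 → 𝓥.abut x.2 = some v →
        𝓥.mapTotalBr γ.hom x = x) → γ = 1

/-! ### Definition 4.1 (iii): `(𝔾, Γ)`-structures -/

/-- The `Γ`-orbit of an arrow `s : H → 𝔾` [relative to the action of `Γ` on `𝔾`].
[cite: MochizukiSemiAnbd2006, Def 4.1 (iii), p. 50] -/
def orbit {H : Obj} (s : H ⟶ G) : Set (H ⟶ G) := {t | ∃ γ ∈ Γ, t = s ≫ γ.hom}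

/-- **Def 4.1 (iii)**: a *`(𝔾, Γ)`-structure* on `H` is "any `Γ`-orbit of locally finite étale
morphisms … `H → 𝔾`"; its members are the *structure morphisms*.
[cite: MochizukiSemiAnbd2006, Def 4.1 (iii), p. 50] -/
structure GStructure (H : Obj) where
  /-- the set of structure morphisms -/
  mor : Set (H ⟶ G)
  /-- it is the `Γ`-orbit of a locally finite étale arrow -/
  exists_orbit : ∃ s : H ⟶ G, 𝓥.IsLocallyFiniteEtale s ∧ mor = orbit G Γ s

variable {G Γ}

/-- The `(𝔾, Γ)`-structure generated by a locally finite étale arrow `s : H → 𝔾` (its orbit).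
[cite: MochizukiSemiAnbd2006, Def 4.1 (iii), p. 50] -/
def GStructure.ofHom {H : Obj} (s : H ⟶ G) (hs : 𝓥.IsLocallyFiniteEtale s) : GStructure 𝓥 G Γ H :=
  ⟨orbit G Γ s, s, hs, rfl⟩

/-- **Def 4.1 (iii)** *iso-immersive*: some structure morphism "factors as the composite of an
immersion `H → 𝔾'` with a finite étale morphism `𝔾' → 𝔾` such that `𝔾'` is untangled".
[cite: MochizukiSemiAnbd2006, Def 4.1 (iii), p. 50] -/
def GStructure.IsIsoImmersive {H : Obj} (S : GStructure 𝓥 G Γ H) : Prop :=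
  ∃ s ∈ S.mor, ∃ (G' : Obj) (i : H ⟶ G') (p : G' ⟶ G),
    𝓥.IsImmersion i ∧ 𝓥.IsFiniteEtale p ∧ 𝓥.IsUntangled G' ∧ i ≫ p = s

/-- **Def 4.1 (iii)** *iso-excisive*: some structure morphism factors as an excision `H → 𝔾'`
followed by a finite étale `𝔾' → 𝔾` with `𝔾'` untangled. [cite: MochizukiSemiAnbd2006, Def 4.1 (iii), p. 50] -/
def GStructure.IsIsoExcisive {H : Obj} (S : GStructure 𝓥 G Γ H) : Prop :=
  ∃ s ∈ S.mor, ∃ (G' : Obj) (i : H ⟶ G') (p : G' ⟶ G),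
    𝓥.IsExcision i ∧ 𝓥.IsFiniteEtale p ∧ 𝓥.IsUntangled G' ∧ i ≫ p = s

/-- **Def 4.1 (iii)**: a (locally finite étale) arrow `f : H → H'` between objects with
`(𝔾, Γ)`-structures is *compatible* with them if "the composite of this morphism with a structure
morphism of `H'` yields a structure morphism of `H`". [cite: MochizukiSemiAnbd2006, Def 4.1 (iii), p. 50] -/
def GStructure.Compatible {H H' : Obj} (f : H ⟶ H') (S : GStructure 𝓥 G Γ H)
    (S' : GStructure 𝓥 G Γ H') : Prop :=
  ∀ s' ∈ S'.mor, f ≫ s' ∈ S.mor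

/-! ### Definition 4.1 (iv): local `(𝔾, Γ)`-structures -/

/-- **Def 4.1 (iv)**: a *local `(𝔾, Γ)`-structure* on `H` is a `(𝔾, Γ)`-structure on each `H[c]`,
`c` a component (vertex or edge) of `H`, such that "if a branch `b` of an edge `e` abuts to a vertex
`v`, then the given `(𝔾, Γ)`-structures on `H[v]`, `H[e]` coincide on `H[b]`" (pulled back along
`H[b] → H[v]`, `H[b] → H[e]`). [cite: MochizukiSemiAnbd2006, Def 4.1 (iv), pp. 50–51] -/
structure LocalGStructure (G : Obj) (Γ : Subgroup (Aut G)) (H : Obj) where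
  /-- the `(𝔾, Γ)`-structure on `H[v]` -/
  atV : (v : 𝓥.Vert H) → GStructure 𝓥 G Γ (𝓥.locV H v)
  /-- the `(𝔾, Γ)`-structure on `H[e]` -/
  atE : (e : 𝓥.Edge H) → GStructure 𝓥 G Γ (𝓥.locE H e)
  /-- the structures at `v` and `e` coincide on `H[b]` when `b ∈ e` abuts to `v` -/
  coincide : ∀ (e : 𝓥.Edge H) (b : 𝓥.Br e) (v : 𝓥.Vert H) (h : 𝓥.abut b = some v),
    {t | ∃ s ∈ (atV v).mor, t = 𝓥.βV H b v h ≫ s} = {t | ∃ s ∈ (atE e).mor, t = 𝓥.βE H b ≫ s}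

/-- **Def 4.1 (iv)**: a local `(𝔾, Γ)`-structure is *iso-immersive* if each constituent
`(𝔾, Γ)`-structure is. [cite: MochizukiSemiAnbd2006, Def 4.1 (iv), p. 51] -/
def LocalGStructure.IsIsoImmersive {H : Obj} (L : LocalGStructure 𝓥 G Γ H) : Prop :=
  (∀ v, (L.atV v).IsIsoImmersive) ∧ ∀ e, (L.atE e).IsIsoImmersive

/-- **Def 4.1 (iv)** *iso-excisive*: each constituent structure is iso-excisive.
[cite: MochizukiSemiAnbd2006, Def 4.1 (iv), p. 51] -/
def LocalGStructure.IsIsoExcisive {H : Obj} (L : LocalGStructure 𝓥 G Γ H) : Prop :=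
  (∀ v, (L.atV v).IsIsoExcisive) ∧ ∀ e, (L.atE e).IsIsoExcisive

/-- **Def 4.1 (iv)** *verticially iso-excisive*: each constituent structure at a vertex is
iso-excisive. [cite: MochizukiSemiAnbd2006, Def 4.1 (iv), p. 51] -/
def LocalGStructure.IsVerticiallyIsoExcisive {H : Obj} (L : LocalGStructure 𝓥 G Γ H) : Prop :=
  ∀ v, (L.atV v).IsIsoExcisive

/-- **Def 4.1 (iv)**: an arrow `f : H → H'` is *compatible with local `(𝔾, Γ)`-structures* if
"each of the induced morphisms `H[c] → H'[c']` (where `c` is a component of `H` mapping to `c'`) is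
compatible with the given `(𝔾, Γ)`-structures". [cite: MochizukiSemiAnbd2006, Def 4.1 (iv), p. 51] -/
def LocalGStructure.Compatible {H H' : Obj} (f : H ⟶ H') (L : LocalGStructure 𝓥 G Γ H)
    (L' : LocalGStructure 𝓥 G Γ H') : Prop :=
  (∀ (v : 𝓥.Vert H) (v' : 𝓥.Vert H') (h : 𝓥.mapV f v = v'),
      (L.atV v).Compatible 𝓥 (𝓥.locMapV f v v' h) (L'.atV v')) ∧
    ∀ (e : 𝓥.Edge H) (e' : 𝓥.Edge H') (h : 𝓥.mapE f e = e'),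
      (L.atE e).Compatible 𝓥 (𝓥.locMapE f e e' h) (L'.atE e')

/-- The local `(𝔾, Γ)`-structure induced by a `𝔾`-structure `p : H → 𝔾` (p.51: tempered objects
"equipped with the resulting `𝔾`-structure"): at `H[c]` the orbit of `H[c] → H → 𝔾`.
[cite: MochizukiSemiAnbd2006, §4, p. 51] -/
def LocalGStructure.induced {H : Obj} (p : H ⟶ G) (hp : 𝓥.IsLocallyFiniteEtale p) :
    LocalGStructure 𝓥 G Γ H where
  atV v := GStructure.ofHom 𝓥 (𝓥.ιV H v ≫ p)
    (𝓥.isLocallyFiniteEtale_comp _ _ (𝓥.isLocallyFiniteEtale_ιV H v) hp)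
  atE e := GStructure.ofHom 𝓥 (𝓥.ιE H e ≫ p)
    (𝓥.isLocallyFiniteEtale_comp _ _ (𝓥.isLocallyFiniteEtale_ιE H e) hp)
  coincide e b v h := by
    ext t
    simp only [GStructure.ofHom, orbit, Set.mem_setOf_eq]
    constructor
    · rintro ⟨s, ⟨γ, hγ, rfl⟩, rfl⟩
      exact ⟨𝓥.ιE H e ≫ p ≫ γ.hom, ⟨γ, hγ, by simp⟩, by
        rw [← Category.assoc, ← Category.assoc, 𝓥.βV_ι, ← Category.assoc, 𝓥.βE_ι,
          Category.assoc]⟩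
    · rintro ⟨s, ⟨γ, hγ, rfl⟩, rfl⟩
      exact ⟨𝓥.ιV H v ≫ p ≫ γ.hom, ⟨γ, hγ, by simp⟩, by
        rw [← Category.assoc, ← Category.assoc, 𝓥.βE_ι, ← Category.assoc, 𝓥.βV_ι,
          Category.assoc]⟩

/-! ### Remark 4.1.1: `𝔾`-open and `𝔾`-closed edges -/

/-- **Rmk 4.1.1**: the `Γ`-orbit of vertices of `𝔾` determined by a vertex `v` of `H` "by mapping
[it] to `𝔾` via a structure morphism" of `H[v]`. [cite: MochizukiSemiAnbd2006, Rmk 4.1.1, p. 51] -/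
def LocalGStructure.vertexOrbit {H : Obj} (L : LocalGStructure 𝓥 G Γ H) (v : 𝓥.Vert H) :
    Set (𝓥.Vert G) :=
  {w | ∃ s ∈ (L.atV v).mor, w = 𝓥.mapV s (𝓥.centerV H v)}

/-- **Rmk 4.1.1**: the `Γ`-orbit of edges of `𝔾` over which an edge `e` of `H` lies.
[cite: MochizukiSemiAnbd2006, Rmk 4.1.1, p. 51] -/
def LocalGStructure.edgeOrbit {H : Obj} (L : LocalGStructure 𝓥 G Γ H) (e : 𝓥.Edge H) :
    Set (𝓥.Edge G) :=
  {e₀ | ∃ s ∈ (L.atE e).mor, e₀ = 𝓥.mapE s (𝓥.centerE H e)}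

/-- **Rmk 4.1.1**: the edge `e` of `H` is *`𝔾`-closed* if it lies over a closed edge of `𝔾`
(automorphisms preserve closedness, so "some" = "every" structure morphism).
[cite: MochizukiSemiAnbd2006, Rmk 4.1.1, p. 51] -/
def LocalGStructure.IsGClosed {H : Obj} (L : LocalGStructure 𝓥 G Γ H) (e : 𝓥.Edge H) : Prop :=
  ∃ e₀ ∈ L.edgeOrbit 𝓥 e, 𝓥.IsClosedEdge e₀

/-- **Rmk 4.1.1**: the edge `e` of `H` is *`𝔾`-open* if it lies over an open edge of `𝔾`.
[cite: MochizukiSemiAnbd2006, Rmk 4.1.1, p. 51] -/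
def LocalGStructure.IsGOpen {H : Obj} (L : LocalGStructure 𝓥 G Γ H) (e : 𝓥.Edge H) : Prop :=
  ∃ e₀ ∈ L.edgeOrbit 𝓥 e, 𝓥.IsOpenEdge e₀

variable (G Γ) in
/-- **Rmk 4.1.1, the claim** ("one verifies immediately"): any locally finite étale arrow
compatible with given local `(𝔾, Γ)`-structures maps `𝔾`-open (resp. `𝔾`-closed) edges to
`𝔾`-open (resp. `𝔾`-closed) edges.  Typed as a predicate on the interface; not proved here.
[cite: MochizukiSemiAnbd2006, Rmk 4.1.1, p. 51] -/
def GOpenClosedPreservedStatement : Prop :=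
  ∀ (H H' : Obj) (L : LocalGStructure 𝓥 G Γ H) (L' : LocalGStructure 𝓥 G Γ H') (f : H ⟶ H'),
    𝓥.IsLocallyFiniteEtale f → L.Compatible 𝓥 f L' → ∀ e : 𝓥.Edge H,
      (L.IsGOpen 𝓥 e → L'.IsGOpen 𝓥 (𝓥.mapE f e)) ∧ (L.IsGClosed 𝓥 e → L'.IsGClosed 𝓥 (𝓥.mapE f e))

/-! ### The category `Loc(𝔾, Γ)` (pp.51–52) -/

variable (G Γ) in
/-- The standing hypotheses under which "we may define a category of localizations" (p.51):
`Γ` [finite] acts piecewise faithfully and `𝔾` is finite, connected, coherent, totally elevated,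
totally universally sub-coverticial (and totally aloof, verticially slim: ambient).
[cite: MochizukiSemiAnbd2006, §4, p. 51] -/
structure LocHypotheses : Prop where
  /-- `Γ` is a finite group -/
  finite : Finite Γ
  /-- `Γ` acts piecewise faithfully (Def 4.1 (i)) -/
  piecewiseFaithful : IsPiecewiseFaithful 𝓥 G Γ
  /-- `𝔾` is finite -/
  isFinite : 𝓥.IsFinite G
  /-- `𝔾` is connected -/
  isConnected : 𝓥.IsConnected G
  /-- `𝔾` is coherent -/
  isCoherent : 𝓥.IsCoherent G
  /-- `𝔾` is totally elevated -/
  isTotallyElevated : 𝓥.IsTotallyElevated G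
  /-- `𝔾` is totally universally sub-coverticial -/
  isTotallyUnivSubcoverticial : 𝓥.IsTotallyUnivSubcoverticial G

/-- A *finite open* datum on `H` with local structure `L` (p.51): `H` finite, connected,
quasi-coherent, totally elevated, totally universally sub-coverticial [totally aloof, verticially
slim: ambient]; `L` iso-immersive and verticially iso-excisive; and `H` "contains at least one
non-isolated open edge [verticial cardinality 1] which is, however, `𝔾`-closed".
[cite: MochizukiSemiAnbd2006, §4, pp. 51–52] -/
structure IsFiniteOpenDatum (H : Obj) (L : LocalGStructure 𝓥 G Γ H) : Prop where
  /-- `H` is finite -/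
  isFinite : 𝓥.IsFinite H
  /-- `H` is connected -/
  isConnected : 𝓥.IsConnected H
  /-- `H` is quasi-coherent -/
  isQuasiCoherent : 𝓥.IsQuasiCoherent H
  /-- `H` is totally elevated -/
  isTotallyElevated : 𝓥.IsTotallyElevated H
  /-- `H` is totally universally sub-coverticial -/
  isTotallyUnivSubcoverticial : 𝓥.IsTotallyUnivSubcoverticial H
  /-- the local `(𝔾, Γ)`-structure is iso-immersive -/
  isoImmersive : L.IsIsoImmersive
  /-- … and verticially iso-excisive -/
  vertIsoExcisive : L.IsVerticiallyIsoExcisive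
  /-- a non-isolated open edge which is `𝔾`-closed -/
  exists_edge : ∃ e : 𝓥.Edge H, 𝓥.vertCard e = 1 ∧ L.IsGClosed 𝓥 e

variable (G Γ) in
/-- The objects of `Loc(𝔾, Γ)` (pp.51–52), as records: the underlying semi-graph of anabelioids
`U`, its local `(𝔾, Γ)`-structure `L`, and for TEMPERED objects (closed or infinite open) the
`𝔾`-structure `str = some p` (then `L` is the induced one and `U` is a connected finite étale,
resp. tempered non-finite-étale, covering of `𝔾` via `p`); `str = none` for FINITE OPEN objects.
[cite: MochizukiSemiAnbd2006, §4, pp. 51–52] -/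
structure LocObj where
  /-- the underlying semi-graph of anabelioids -/
  U : Obj
  /-- its local `(𝔾, Γ)`-structure -/
  L : LocalGStructure 𝓥 G Γ U
  /-- the `𝔾`-structure of a tempered object; `none` for a finite open object -/
  str : Option (U ⟶ G)
  /-- tempered objects: connected finite étale / infinite-degree tempered coverings of `𝔾`, with
  the induced local structure -/
  tempered_wf : ∀ p, str = some p → 𝓥.IsConnected U ∧ 𝓥.IsTempered p ∧
    ∃ hp : 𝓥.IsLocallyFiniteEtale p, L = LocalGStructure.induced 𝓥 p hp
  /-- finite open objects -/
  finOpen_wf : str = none → IsFiniteOpenDatum 𝓥 U L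

namespace LocObj

/-- closed objects: "the connected finite étale coverings `𝔾'` of `𝔾`". [cite: MochizukiSemiAnbd2006, §4, p. 51] -/
def IsClosed (X : LocObj 𝓥 G Γ) : Prop := ∃ p, X.str = some p ∧ 𝓥.IsFiniteEtale p

/-- infinite open objects: connected tempered coverings of `𝔾` "of infinite degree" [not finite
étale]. [cite: MochizukiSemiAnbd2006, §4, p. 51] -/
def IsInfiniteOpen (X : LocObj 𝓥 G Γ) : Prop := ∃ p, X.str = some p ∧ ¬ 𝓥.IsFiniteEtale p

/-- tempered objects: closed or infinite open. [cite: MochizukiSemiAnbd2006, §4, p. 51] -/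
def IsTemperedObj (X : LocObj 𝓥 G Γ) : Prop := X.str.isSome

/-- finite open objects. [cite: MochizukiSemiAnbd2006, §4, p. 51] -/
def IsFiniteOpen (X : LocObj 𝓥 G Γ) : Prop := X.str = none

/-- open objects: finite open or infinite open. [cite: MochizukiSemiAnbd2006, §4, pp. 51–52] -/
def IsOpenObj (X : LocObj 𝓥 G Γ) : Prop := X.IsFiniteOpen ∨ X.IsInfiniteOpen

/-- The arrows of `Loc(𝔾, Γ)` (p.52): locally finite étale arrows of semi-graphs of anabelioids
which, between tempered objects, are compatible with the `𝔾`-structures [lie over `𝔾`]; out of a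
finite open object, are compatible with the local `(𝔾, Γ)`-structures; "there are no morphisms
from a tempered to a finite open object". [cite: MochizukiSemiAnbd2006, §4, p. 52] -/
def HomCond (X Y : LocObj 𝓥 G Γ) (f : X.U ⟶ Y.U) : Prop :=
  𝓥.IsLocallyFiniteEtale f ∧ (∀ p q, X.str = some p → Y.str = some q → f ≫ q = p) ∧
    (X.str.isSome → Y.str.isSome) ∧ (X.str = none → X.L.Compatible 𝓥 f Y.L)

end LocObj

/-- An arrow of `Loc(𝔾, Γ)`. [cite: MochizukiSemiAnbd2006, §4, p. 52] -/
@[ext] structure LocHom (X Y : LocObj 𝓥 G Γ) where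
  /-- the underlying arrow of semi-graphs of anabelioids -/
  hom : X.U ⟶ Y.U
  /-- it satisfies the conditions of p.52 -/
  cond : LocObj.HomCond 𝓥 X Y hom

/-- Identities are compatible with local `(𝔾, Γ)`-structures. [cite: MochizukiSemiAnbd2006, Def 4.1 (iv), p. 51] -/
theorem LocalGStructure.compatible_id {H : Obj} (L : LocalGStructure 𝓥 G Γ H) :
    L.Compatible 𝓥 (𝟙 H) L := by
  refine ⟨fun v v' h s' hs' => ?_, fun e e' h s' hs' => ?_⟩
  · obtain rfl : v = v' := by rw [𝓥.mapV_id] at h; exact h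
    rw [𝓥.locMapV_id, Category.id_comp]; exact hs'
  · obtain rfl : e = e' := by rw [𝓥.mapE_id] at h; exact h
    rw [𝓥.locMapE_id, Category.id_comp]; exact hs'

/-- Composites of compatible arrows are compatible. [cite: MochizukiSemiAnbd2006, Def 4.1 (iv), p. 51] -/
theorem LocalGStructure.compatible_comp {H H' H'' : Obj} {L : LocalGStructure 𝓥 G Γ H}
    {L' : LocalGStructure 𝓥 G Γ H'} {L'' : LocalGStructure 𝓥 G Γ H''} {f : H ⟶ H'}
    {g : H' ⟶ H''} (hf : L.Compatible 𝓥 f L') (hg : L'.Compatible 𝓥 g L'') :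
    L.Compatible 𝓥 (f ≫ g) L'' := by
  refine ⟨fun v v'' h s'' hs'' => ?_, fun e e'' h s'' hs'' => ?_⟩
  · rw [𝓥.locMapV_comp f g v (𝓥.mapV f v) v'' rfl (by rw [𝓥.mapV_comp] at h; exact h) h,
      Category.assoc]
    exact hf.1 v _ rfl _ (hg.1 _ v'' _ s'' hs'')
  · rw [𝓥.locMapE_comp f g e (𝓥.mapE f e) e'' rfl (by rw [𝓥.mapE_comp] at h; exact h) h,
      Category.assoc]
    exact hf.2 e _ rfl _ (hg.2 _ e'' _ s'' hs'')

/-- An arrow over `𝔾` between objects with INDUCED local structures is compatible with them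
(p.52: morphisms between tempered objects are "compatible with the `𝔾`-structure").
[cite: MochizukiSemiAnbd2006, §4, p. 52] -/
theorem LocalGStructure.compatible_induced {H H' : Obj} {p : H ⟶ G} {q : H' ⟶ G}
    (hp : 𝓥.IsLocallyFiniteEtale p) (hq : 𝓥.IsLocallyFiniteEtale q) {f : H ⟶ H'}
    (hf : f ≫ q = p) :
    (LocalGStructure.induced 𝓥 p hp).Compatible 𝓥 f (LocalGStructure.induced 𝓥 (Γ := Γ) q hq) := by
  refine ⟨fun v v' h s' hs' => ?_, fun e e' h s' hs' => ?_⟩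
  · obtain ⟨γ, hγ, rfl⟩ := hs'
    refine ⟨γ, hγ, ?_⟩
    have key : 𝓥.locMapV f v v' h ≫ 𝓥.ιV H' v' ≫ q = 𝓥.ιV H v ≫ p := by
      rw [← Category.assoc, 𝓥.locMapV_ι, Category.assoc, hf]
    simp only [← key, Category.assoc]
  · obtain ⟨γ, hγ, rfl⟩ := hs'
    refine ⟨γ, hγ, ?_⟩
    have key : 𝓥.locMapE f e e' h ≫ 𝓥.ιE H' e' ≫ q = 𝓥.ιE H e ≫ p := by
      rw [← Category.assoc, 𝓥.locMapE_ι, Category.assoc, hf]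
    simp only [← key, Category.assoc]

/-- `Loc(𝔾, Γ)` is a category (composition = composition of underlying arrows).
[cite: MochizukiSemiAnbd2006, §4, p. 52] -/
instance : Category (LocObj 𝓥 G Γ) where
  Hom X Y := LocHom 𝓥 X Y
  id X := ⟨𝟙 X.U, 𝓥.isLocallyFiniteEtale_id X.U, fun p q hp hq => by
      rw [hp] at hq; cases hq; simp, id, fun _ => X.L.compatible_id 𝓥⟩
  comp {X Y Z} f g := ⟨f.hom ≫ g.hom, by
    obtain ⟨hf₁, hf₂, hf₃, hf₄⟩ := f.cond
    obtain ⟨hg₁, hg₂, hg₃, hg₄⟩ := g.cond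
    refine ⟨𝓥.isLocallyFiniteEtale_comp _ _ hf₁ hg₁, fun p r hp hr => ?_, fun h => hg₃ (hf₃ h),
      fun hX => ?_⟩
    · obtain ⟨q, hq⟩ := Option.isSome_iff_exists.mp (hf₃ (by rw [hp]; rfl))
      rw [Category.assoc, hg₂ q r hq hr, hf₂ p q hp hq]
    · rcases hY : Y.str with _ | q
      · exact LocalGStructure.compatible_comp 𝓥 (hf₄ hX) (hg₄ hY)
      · obtain ⟨r, hr⟩ := Option.isSome_iff_exists.mp (hg₃ (by rw [hY]; rfl))
        obtain ⟨-, -, hq', hLY⟩ := Y.tempered_wf q hY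
        obtain ⟨-, -, hr', hLZ⟩ := Z.tempered_wf r hr
        have hc := hf₄ hX
        rw [hLY] at hc
        rw [hLZ]
        exact LocalGStructure.compatible_comp 𝓥 hc
          (LocalGStructure.compatible_induced 𝓥 hq' hr' (hg₂ q r hY hr))⟩

/-- The underlying arrow of a composite. [cite: MochizukiSemiAnbd2006, §4, p. 52] -/
@[simp] theorem comp_hom {X Y Z : LocObj 𝓥 G Γ} (f : X ⟶ Y) (g : Y ⟶ Z) :
    (f ≫ g).hom = f.hom ≫ g.hom := rfl

/-- The underlying arrow of an identity. [cite: MochizukiSemiAnbd2006, §4, p. 52] -/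
@[simp] theorem id_hom (X : LocObj 𝓥 G Γ) : (𝟙 X : X ⟶ X).hom = 𝟙 X.U := rfl

end Loc

end Literature.AnabelianGeometry.SemiGraphs
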